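import Literature.Probability.LatticeModels.HalfPlaneClusterSides
import Literature.Probability.LatticeModels.IsingFiniteEnergy
import HarnessLib

/-!
# Uniqueness of the infinite component off a box (GH2000, §5, "the infinite component of `I ∖ Δ`")

Topic `Probability/LatticeModels`. Georgii–Higuchi 2000, proof of the pinning lemma (Lemma 5.2,
p. 1160): "By hypothesis, *the* infinite component of `I^{+∗}_up ∖ Δ` almost surely contains
infinitely many points of `ℓ_right`", and Case 3 of the proof of Lemma 5.5: "`y` is `-∗`connected
off `Δ` to `I⁻_up(ω)`, *and thus* to the `-`face of `γ_up(ω)`". Both steps use that, almost surely,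
the infinite clusters of the upper half-plane keep a **unique** infinite component after the
square `Δ = Λ_m` is removed. We prove this in the coexistence situation of §5 (an infinite
`+∗`cluster and an infinite `-`cluster in `π_up`), where the infinite `+∗`cluster and the infinite
`-`cluster of `π_up` are almost surely unique (`ae_plusStar_cluster_unique`,
`ae_minus_cluster_unique`, from the line touching lemma):

* `ae_offBox_plusStar_unique` — a.s., for every `m`, any two infinite `∗`-clusters of
  `S⁺ ∩ (π_up ∖ Λ_m)` coincide;
* `ae_offBox_minus_unique` — the same for the lattice clusters of `S⁻ ∩ (π_up ∖ Λ_m)`.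

Proof (finite energy transfer): setting the spins of `Λ_m ∩ π_up` to `-1` turns the `∗`-clusters of
`S⁺ ∩ (π_up ∖ Λ_m)` into the `+∗`clusters of `π_up` of the modified configuration and only enlarges
the `-`clusters; the modified configurations avoid the null set "two infinite `+∗`clusters of
`π_up`" almost surely, because `δ_Λ μ{η : glue(η) ∈ N} ≤ μ(N) = 0`
(`IsGibbsMeasure.mul_measure_glueWith_preimage_le`, Georgii–Higuchi's finite energy property).

## References

* H.-O. Georgii, Y. Higuchi, *Percolation and number of phases in the two-dimensional Ising
  model*, J. Math. Phys. 41 (2000), Lemma 5.2 (proof) and Lemma 5.5 (proof, Case 3); Lemma 4.1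
  [GeorgiiHiguchi2000].
-/

noncomputable section

open MeasureTheory Filter SimpleGraph Finset
open Literature.Probability.Percolation
open scoped ENNReal

namespace Literature.Probability.LatticeModels

variable {β : ℝ} {μ : Measure (SpinConfig (Site 2))}

/-! ### Gluing the upper half of the box -/

section Glue

variable (m : ℕ)

/-- Setting the spins of `Λ_m ∩ π_up` to `-s` removes `Λ_m` from the `s`-sites of `π_up`. [folklore] -/
theorem spinSites_glue_upperBox_inter_halfPlane (s : ℤˣ) (η : SpinConfig (Site 2)) :
    spinSites s (glueWith ((box 2 m).filter fun z : Site 2 => 0 ≤ z 1) (fun _ => -s) η) ∩ halfPlane 0 =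
      spinSites s η ∩ (halfPlane 0 \ ↑(box 2 m)) := by
  classical
  have hne : (-s : ℤˣ) ≠ s := by rcases Int.units_eq_one_or s with rfl | rfl <;> decide
  ext z
  simp only [Set.mem_inter_iff, mem_spinSites, halfPlane, Set.mem_setOf_eq, Set.mem_sdiff, Finset.mem_coe]
  by_cases hz : z ∈ (box 2 m).filter fun z : Site 2 => 0 ≤ z 1
  · rw [glueWith_apply_mem _ _ _ hz]
    rw [Finset.mem_filter] at hz
    constructor
    · rintro ⟨h, -⟩; exact absurd h hne
    · rintro ⟨-, -, h⟩; exact absurd hz.1 h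
  · rw [glueWith_apply_not_mem _ _ _ hz]
    rw [Finset.mem_filter, not_and] at hz
    constructor
    · rintro ⟨h, h0⟩; exact ⟨h, h0, fun hb => hz hb h0⟩
    · rintro ⟨h, h0, -⟩; exact ⟨h, h0⟩

/-- Setting the spins of `Λ_m ∩ π_up` to `-s` only enlarges the `-s`-sites of `π_up`. [folklore] -/
theorem spinSites_inter_halfPlane_subset_glue_upperBox (s : ℤˣ) (η : SpinConfig (Site 2)) :
    spinSites (-s) η ∩ halfPlane 0 ⊆
      spinSites (-s) (glueWith ((box 2 m).filter fun z : Site 2 => 0 ≤ z 1) (fun _ => -s) η) ∩ halfPlane 0 := by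
  classical
  rintro z ⟨hz, hz0⟩
  refine ⟨?_, hz0⟩
  rw [mem_spinSites] at hz ⊢
  by_cases h : z ∈ (box 2 m).filter fun z : Site 2 => 0 ≤ z 1
  · rw [glueWith_apply_mem _ _ _ h]
  · rw [glueWith_apply_not_mem _ _ _ h]; exact hz

/-- **Finite energy transfer of null sets**: if `N` is `μ`-null for a Gibbs measure `μ`, then almost
surely the configuration glued on a finite set does not lie in `N`
(`δ_Λ μ{η : glue η ∈ N} ≤ μ(N)`). [cite: GeorgiiHiguchi2000, Lemma 3.4 (proof, finite energy)] -/
theorem ae_glueWith_notMem_of_null (hμ : μ ∈ isingGibbsMeasures 2 β 0) (Λ : Finset (Site 2)) (τ : Λ → ℤˣ)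
    {N : Set (SpinConfig (Site 2))} (hN : μ N = 0) :
    ∀ᵐ η ∂μ, glueWith Λ τ η ∉ N := by
  classical
  have hμG : IsGibbsMeasure (isingSpecification (zdGraph 2) β 0) μ := hμ
  obtain ⟨N', hNN', hN'm, hμN'⟩ := exists_measurable_superset_of_null hN
  have key := hμG.mul_measure_glueWith_preimage_le (G := zdGraph 2) Λ τ hN'm
  rw [hμN', nonpos_iff_eq_zero, mul_eq_zero] at key
  have hδ : ENNReal.ofReal (Real.exp (-(2 * |β| * (#(edgesTouching (zdGraph 2) Λ) + |(0 : ℝ)| * #Λ))) / 2 ^ #Λ) ≠ 0 :=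
    (ENNReal.ofReal_pos.2 (div_pos (Real.exp_pos _) (pow_pos two_pos _))).ne'
  have h0 : μ {η | glueWith Λ τ η ∈ N'} = 0 := key.resolve_left hδ
  filter_upwards [measure_eq_zero_iff_ae_notMem.1 h0] with η hη h
  exact hη (hNN' h)

end Glue

/-! ### Uniqueness off the box -/

section Unique

/-- **Uniqueness of the infinite `+∗`component off a box, almost surely** (the step "the infinite
component of `I^{+∗}_up ∖ Δ`" of Georgii–Higuchi 2000, Lemma 5.2, in the coexistence case): for
`β > β_c(2)` and `μ ∈ 𝒢(β, 0)`, almost surely, for every `m`, whenever the upper half-plane contains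
an infinite `-`cluster, any two infinite `∗`-clusters of `S⁺ ∩ (π_up ∖ Λ_m)` coincide. [cite: GeorgiiHiguchi2000, Lemma 5.2 (proof) and Lemma 4.1] -/
theorem ae_offBox_plusStar_unique (hβc : criticalBeta 2 < β) (hμ : μ ∈ isingGibbsMeasures 2 β 0) :
    ∀ᵐ ω ∂μ, ∀ (m : ℕ) (x₁ x₂ y : Site 2),
      (siteCluster zdStarGraph (spinSites 1 ω ∩ (halfPlane 0 \ ↑(box 2 m))) x₁).Infinite →
      (siteCluster zdStarGraph (spinSites 1 ω ∩ (halfPlane 0 \ ↑(box 2 m))) x₂).Infinite →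
      (siteCluster (zdGraph 2) (spinSites (-1) ω ∩ halfPlane 0) y).Infinite →
        siteCluster zdStarGraph (spinSites 1 ω ∩ (halfPlane 0 \ ↑(box 2 m))) x₁ =
          siteCluster zdStarGraph (spinSites 1 ω ∩ (halfPlane 0 \ ↑(box 2 m))) x₂ := by
  classical
  have hμG : IsGibbsMeasure (isingSpecification (zdGraph 2) β 0) μ := hμ
  haveI := hμG.isProbabilityMeasure
  rw [ae_all_iff]
  intro m
  set Λ : Finset (Site 2) := (box 2 m).filter fun z : Site 2 => 0 ≤ z 1 with hΛ
  -- the null set "two infinite `+∗`clusters of `π_up` (and an infinite `-`cluster)"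
  set N : Set (SpinConfig (Site 2)) := {ω | ∃ x₁ x₂ y : Site 2,
      (siteCluster zdStarGraph (spinSites 1 ω ∩ halfPlane 0) x₁).Infinite ∧
      (siteCluster zdStarGraph (spinSites 1 ω ∩ halfPlane 0) x₂).Infinite ∧
      (siteCluster (zdGraph 2) (spinSites (-1) ω ∩ halfPlane 0) y).Infinite ∧
      siteCluster zdStarGraph (spinSites 1 ω ∩ halfPlane 0) x₁ ≠
        siteCluster zdStarGraph (spinSites 1 ω ∩ halfPlane 0) x₂} with hN
  have hNnull : μ N = 0 := by
    have h := ae_plusStar_cluster_unique hβc hμ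
    rw [ae_iff] at h
    refine measure_mono_null ?_ h
    rintro ω ⟨x₁, x₂, y, h₁, h₂, hy, hne⟩ hall
    exact hne (hall x₁ x₂ y h₁ h₂ hy)
  filter_upwards [ae_glueWith_notMem_of_null hμ Λ (fun _ => (-1 : ℤˣ)) hNnull] with ω hω x₁ x₂ y h₁ h₂ hy
  by_contra hne
  refine hω ⟨x₁, x₂, y, ?_, ?_, ?_, ?_⟩
  · rw [show (-1 : ℤˣ) = -(1 : ℤˣ) from rfl, spinSites_glue_upperBox_inter_halfPlane m 1 ω]; exact h₁
  · rw [show (-1 : ℤˣ) = -(1 : ℤˣ) from rfl, spinSites_glue_upperBox_inter_halfPlane m 1 ω]; exact h₂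
  · exact hy.mono (siteCluster_mono (by
      have := spinSites_inter_halfPlane_subset_glue_upperBox m 1 ω
      simpa using this) y)
  · rw [show (-1 : ℤˣ) = -(1 : ℤˣ) from rfl, spinSites_glue_upperBox_inter_halfPlane m 1 ω]; exact hne

/-- **Uniqueness of the infinite `-`component off a box, almost surely** (the step "`y` is
`-∗`connected off `Δ` to `I⁻_up(ω)`, and thus to the `-`face" of Georgii–Higuchi 2000, Lemma 5.5,
Case 3): for `β > β_c(2)` and `μ ∈ 𝒢(β, 0)`, almost surely, for every `m`, whenever the upper
half-plane contains an infinite `+∗`cluster, any two infinite lattice clusters of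
`S⁻ ∩ (π_up ∖ Λ_m)` coincide. [cite: GeorgiiHiguchi2000, Lemma 5.5 (proof, Case 3) and Lemma 4.1] -/
theorem ae_offBox_minus_unique (hβc : criticalBeta 2 < β) (hμ : μ ∈ isingGibbsMeasures 2 β 0) :
    ∀ᵐ ω ∂μ, ∀ (m : ℕ) (x y₁ y₂ : Site 2),
      (siteCluster zdStarGraph (spinSites 1 ω ∩ halfPlane 0) x).Infinite →
      (siteCluster (zdGraph 2) (spinSites (-1) ω ∩ (halfPlane 0 \ ↑(box 2 m))) y₁).Infinite →
      (siteCluster (zdGraph 2) (spinSites (-1) ω ∩ (halfPlane 0 \ ↑(box 2 m))) y₂).Infinite →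
        siteCluster (zdGraph 2) (spinSites (-1) ω ∩ (halfPlane 0 \ ↑(box 2 m))) y₁ =
          siteCluster (zdGraph 2) (spinSites (-1) ω ∩ (halfPlane 0 \ ↑(box 2 m))) y₂ := by
  classical
  have hμG : IsGibbsMeasure (isingSpecification (zdGraph 2) β 0) μ := hμ
  haveI := hμG.isProbabilityMeasure
  rw [ae_all_iff]
  intro m
  set Λ : Finset (Site 2) := (box 2 m).filter fun z : Site 2 => 0 ≤ z 1 with hΛ
  set N : Set (SpinConfig (Site 2)) := {ω | ∃ x y₁ y₂ : Site 2,
      (siteCluster zdStarGraph (spinSites 1 ω ∩ halfPlane 0) x).Infinite ∧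
      (siteCluster (zdGraph 2) (spinSites (-1) ω ∩ halfPlane 0) y₁).Infinite ∧
      (siteCluster (zdGraph 2) (spinSites (-1) ω ∩ halfPlane 0) y₂).Infinite ∧
      siteCluster (zdGraph 2) (spinSites (-1) ω ∩ halfPlane 0) y₁ ≠
        siteCluster (zdGraph 2) (spinSites (-1) ω ∩ halfPlane 0) y₂} with hN
  have hNnull : μ N = 0 := by
    have h := ae_minus_cluster_unique hβc hμ
    rw [ae_iff] at h
    refine measure_mono_null ?_ h
    rintro ω ⟨x, y₁, y₂, hx, h₁, h₂, hne⟩ hall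
    exact hne (hall x y₁ y₂ hx h₁ h₂)
  filter_upwards [ae_glueWith_notMem_of_null hμ Λ (fun _ => (1 : ℤˣ)) hNnull] with ω hω x y₁ y₂ hx h₁ h₂
  by_contra hne
  have hglue : spinSites (-1) (glueWith Λ (fun _ => (1 : ℤˣ)) ω) ∩ halfPlane 0 =
      spinSites (-1) ω ∩ (halfPlane 0 \ ↑(box 2 m)) := by
    have := spinSites_glue_upperBox_inter_halfPlane m (-1) ω
    simpa using this
  have hsub : spinSites 1 ω ∩ halfPlane 0 ⊆ spinSites 1 (glueWith Λ (fun _ => (1 : ℤˣ)) ω) ∩ halfPlane 0 := by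
    have := spinSites_inter_halfPlane_subset_glue_upperBox m (-1) ω
    simpa using this
  refine hω ⟨x, y₁, y₂, hx.mono (siteCluster_mono hsub x), ?_, ?_, ?_⟩
  · rw [hglue]; exact h₁
  · rw [hglue]; exact h₂
  · rw [hglue]; exact hne

end Unique

end Literature.Probability.LatticeModels
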